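import Literature.Barriers.CriticalPhenomena.PlaquetteWalkAngleLimitPhase
import HarnessLib

/-!
# Barrier catalogue (SAWScalingLimit): the ROW-COHERENT phase classes of the level-`5` limit model and the non-vanishing
criterion they give at a hole root («ROW COHERENCE»)

Continuation of `PlaquetteWalkAngleLimitPhase` (THE PHASE LAW: from a vertical root the `Z → ∞` limit weight of a Yang–Baxter walk
[GlazmanManolescu2019, eq. (1)] is `slotSign · (i√2)^{n_{u₁}+n_{u₂}} · ζ₈^{3(n_{VL}+n_{w₁})+2n_{w₂}}`, and the HALF-PLANE CRITERION).

* `phaseIndex l = (3(n_{VL}+n_{w₁}) + 2n_{w₂}) mod 8` and ★★ `limitWeight_eq_phaseIndex`: `limitWeight_s(γ) = slotSign s ·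
  (ζ⁴+ζ¹²)^{n_{u₁}+n_{u₂}} · ζ^{4·phaseIndex}` for a walk from a vertical mid-edge to a mid-edge with the orientation of the slot `s`.
* ★ `RowCoherent s l` — THE ROW-COHERENT CLASSES: slot `N` with phase index `0`/`2`, `S` with `4`/`6`, `E`/`W` with `1`/`5`. These
  are exactly the classes of the cost-`5` wound members observed at the cells of the ROOT ROW `(w.1 + k, w.2)` in the lane's exact
  census (b-engine-1 g23 kit j271945, g24 kit j276221): the class-`B2a` «rectangles» around the hole returning to `N` (clockwise,
  `n_{VL} = 0`) or to `S` (counter-clockwise, `n_{VL} = 2`), their class-`B2b` extensions to `E`, and the extensions to `N`/`S` of the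
  cost-`7` walks returning to `E`.
* ★★ `re_zeta20_mul_limitWeight_of_rowCoherent`: a row-coherent cost-`5` weight has `Re(ζ²⁰·limitWeight) = 4·slotDeg s` — `4` on the
  slanted slots `N`, `S` (weights `4i√2`, `−4√2`), `0` on the vertical slots (weights `±4ζ₈`, `±4ζ₈⁵`): all in the closed half-plane
  `Re(ζ^{−12}·) ≥ 0` (`zeta32_row_values`: the eight unit values).
* ★★★ `vertexFunctional_printed_zero_set_finite_of_rowCoherent` — THE ROW-COHERENCE CRITERION: at a `W`-normalised hole root, if every
  wound group member of cost `5` at `f₀` is row-coherent and one of them ends on a slanted side, the printed vertex functional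
  `VF_D(a, f₀; ·)` is NOT identically zero in the angle (finitely many zeros in `(0, π)`).

Use (venture lane «pcv-sawmu»): this is the exact shape in which the census law «Λ₅ ≠ 0 at every root-row cell with a cost-5 wound
member» is to be proved — the structural cars (`PlaquetteWalkHoleRootExtremeRowGap`, …) must show that the cost-`5` members at the
root-row cells are row-coherent. Nothing about the classification is claimed here. Elementary (cyclotomic arithmetic in `ℤ[ζ₃₂]`).
-/

noncomputable section

open private IsNS from Literature.Probability.RandomPlanarGeometry.YangBaxterSAWGeneralDomain

namespace Literature.Barriers.CriticalPhenomena.PlaquetteWalk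

open Literature.Probability.RandomPlanarGeometry.SAW.YangBaxter
open Real Complex Polynomial

/-! ## Powers of `ζ` at the multiples of `8` -/

section ZetaQuarter

/-- `ζ⁸ = i`. [cite: GlazmanManolescu2019, §1, eq. (1) (lane plumbing: cyclotomic arithmetic)] -/
theorem zeta32_pow_eight : zeta32 ^ 8 = I := by
  rw [zeta32_pow, show (((8 : ℕ) : ℝ) * π / 16 : ℝ) = π / 2 by push_cast; ring]
  push_cast
  exact Complex.exp_pi_div_two_mul_I

/-- `ζ²⁴ = −i`. [cite: GlazmanManolescu2019, §1, eq. (1) (lane plumbing)] -/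
theorem zeta32_pow_twentyFour : zeta32 ^ 24 = -I := by
  rw [show (24 : ℕ) = 16 + 8 by norm_num, pow_add, zeta32_pow_sixteen, zeta32_pow_eight]; ring

/-- `ζ^{4X}` for `X < 8` reduced: the phase exponent of the phase law, `12(n_{VL}+n_{w₁}) + 8n_{w₂}`, equals `4·X (mod 32)` with
`X = (3(n_{VL}+n_{w₁}) + 2n_{w₂}) mod 8`. [cite: GlazmanManolescu2019, §1, eq. (1) (lane plumbing)] -/
theorem zeta32_pow_phase_eq (A B : ℕ) : zeta32 ^ (12 * A + 8 * B) = zeta32 ^ (4 * ((3 * A + 2 * B) % 8)) := by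
  conv_lhs => rw [show 12 * A + 8 * B = 4 * ((3 * A + 2 * B) % 8) + 32 * ((3 * A + 2 * B) / 8) by omega]
  exact zeta32_pow_add_mul _ _

end ZetaQuarter

/-! ## The phase index and the row-coherent classes -/

section RowCoherent

/-- ★ **THE PHASE INDEX** `X(l) = (3(n_{VL} + n_{w₁}) + 2n_{w₂}) mod 8` of a mid-edge list: by the PHASE LAW the limit weight of a walk
from a vertical root is `slotSign · (i√2)^{n_{u₁}+n_{u₂}} · ζ₈^{X}`. [cite: GlazmanManolescu2019, §1, Fig. 1 and eq. (1); Lemma 2.1, eq. (CR)] -/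
def phaseIndex (l : List MidEdge) : ℕ :=
  (3 * (vlCount l + cfgCount l [.corner, .corner]) + 2 * cfgCount l [.coCorner, .coCorner]) % 8

/-- `phaseIndex l < 8`. [cite: GlazmanManolescu2019, §1, eq. (1) (lane plumbing)] -/
theorem phaseIndex_lt (l : List MidEdge) : phaseIndex l < 8 := Nat.mod_lt _ (by norm_num)

/-- ★ **THE ROW-COHERENT CLASSES** (the level-`5` classes observed at the cells of the root row, lane census kit j271945 / j276221):
slot `N` with phase index `0` or `2`, slot `S` with `4` or `6`, slots `E`/`W` with `1` or `5`. Their limit weights at cost `5` are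
`4i√2`, `−4√2` (`N`, `S`) and `±4ζ₈`, `±4ζ₈⁵` (`E`, `W`): all in the closed half-plane `Re(ζ^{−12}·) ≥ 0`, the slanted ones strictly.
[cite: GlazmanManolescu2019, §1, Fig. 1 and eq. (1); Lemma 2.1, eq. (CR)] -/
def RowCoherent (s : Fin 4) (l : List MidEdge) : Prop :=
  (s = 1 → phaseIndex l = 0 ∨ phaseIndex l = 2) ∧ (s = 3 → phaseIndex l = 4 ∨ phaseIndex l = 6) ∧
    ((s = 0 ∨ s = 2) → phaseIndex l = 1 ∨ phaseIndex l = 5)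

variable {D : Set Face} {a z : MidEdge}

/-- ★★ **THE PHASE LAW WITH THE PHASE INDEX**: for a walk from a vertical mid-edge to a mid-edge whose orientation is that of the slot
`s` (`vertB z = [slotDeg s = 0]`), `limitWeight_s(γ) = slotSign s · (ζ⁴+ζ¹²)^{n_{u₁}+n_{u₂}} · ζ^{4·phaseIndex}`.
[cite: GlazmanManolescu2019, §1, Fig. 1 and eq. (1); Lemma 2.1, eq. (CR); §2.1, eq. (2.1)] -/
theorem limitWeight_eq_phaseIndex (γ : YBWalk D a z) (ha : vertB a = true) (s : Fin 4) (hz : vertB z = (slotDeg s == 0)) :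
    limitWeight s γ.mids = slotSign s * (zeta32 ^ 4 + zeta32 ^ 12) ^ (cfgCount γ.mids [.corner] + cfgCount γ.mids [.coCorner]) *
      zeta32 ^ (4 * phaseIndex γ.mids) := by
  rw [limitWeight_eq_phase γ s, phaseIndex, ← zeta32_pow_phase_eq]
  have hE : (hvCount γ.mids : ℤ) - vhCount γ.mids = slotDeg s := by
    rw [hvCount_sub_vhCount_walk γ, ha, hz]
    unfold slotDeg; fin_cases s <;> simp
  have hslot : slotExp s = 5 * slotDeg s := by unfold slotExp slotDeg; fin_cases s <;> simp
  rw [hE, hslot, zpow_natCast, ← pow_mul, mul_assoc _ (zeta32 ^ (27 * slotDeg s)), ← pow_add,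
    show 27 * slotDeg s + (5 * slotDeg s + 12 * (vlCount γ.mids + cfgCount γ.mids [.corner, .corner]) +
      8 * cfgCount γ.mids [.coCorner, .coCorner]) = (12 * (vlCount γ.mids + cfgCount γ.mids [.corner, .corner]) +
      8 * cfgCount γ.mids [.coCorner, .coCorner]) + 32 * slotDeg s by ring, zeta32_pow_add_mul]

/-- The number of isolated turns of a cost-`5` list: `n_{u₁} + n_{u₂} = 4 + slotDeg s`. [cite: GlazmanManolescu2019, §1, eq. (1); Lemma 2.1, eq. (CR)] -/
theorem isolated_eq_of_cost_five {s : Fin 4} {l : List MidEdge} (hc : cost s l = 5) :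
    cfgCount l [.corner] + cfgCount l [.coCorner] = 4 + slotDeg s := by
  have hs : slotDeg s ≤ 1 := by unfold slotDeg; split_ifs <;> simp
  unfold cost at hc; omega

/-- The eight unit values met by the row-coherent classes: `ζ²⁰ζ⁴ = −i`, `ζ²⁰ζ²⁰ = i`, and `(ζ⁴+ζ¹²)·ζ²⁰ζ^{4X}` for `X = 0, 2, 4, 6`.
[cite: GlazmanManolescu2019, §1, eq. (1) (lane plumbing: cyclotomic arithmetic)] -/
theorem zeta32_row_values :
    zeta32 ^ 20 * zeta32 ^ (4 * 1) = -I ∧ zeta32 ^ 20 * zeta32 ^ (4 * 5) = I ∧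
      (zeta32 ^ 4 + zeta32 ^ 12) * (zeta32 ^ 20 * zeta32 ^ (4 * 0)) = 1 - I ∧
      (zeta32 ^ 4 + zeta32 ^ 12) * (zeta32 ^ 20 * zeta32 ^ (4 * 2)) = 1 + I ∧
      (zeta32 ^ 4 + zeta32 ^ 12) * (zeta32 ^ 20 * zeta32 ^ (4 * 4)) = I - 1 ∧
      (zeta32 ^ 4 + zeta32 ^ 12) * (zeta32 ^ 20 * zeta32 ^ (4 * 6)) = -1 - I := by
  have h8 := zeta32_pow_eight; have h16 := zeta32_pow_sixteen; have h32 := zeta32_pow_thirtyTwo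
  have e24 : zeta32 ^ 24 = -I := zeta32_pow_twentyFour
  have e40 : zeta32 ^ 40 = I := by rw [show (40 : ℕ) = 8 + 32 * 1 by norm_num, zeta32_pow_add_mul, h8]
  have e36 : zeta32 ^ 36 = zeta32 ^ 4 := by rw [show (36 : ℕ) = 4 + 32 * 1 by norm_num, zeta32_pow_add_mul]
  have e44 : zeta32 ^ 44 = zeta32 ^ 12 := by rw [show (44 : ℕ) = 12 + 32 * 1 by norm_num, zeta32_pow_add_mul]
  have e28 : zeta32 ^ 28 = zeta32 ^ 16 * zeta32 ^ 12 := by rw [← pow_add]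
  have e20 : zeta32 ^ 20 = zeta32 ^ 16 * zeta32 ^ 4 := by rw [← pow_add]
  have p1 : zeta32 ^ 4 * zeta32 ^ 4 = zeta32 ^ 8 := by rw [← pow_add]
  have p2 : zeta32 ^ 4 * zeta32 ^ 12 = zeta32 ^ 16 := by rw [← pow_add]
  have p3 : zeta32 ^ 12 * zeta32 ^ 12 = zeta32 ^ 24 := by rw [← pow_add]
  refine ⟨?_, ?_, ?_, ?_, ?_, ?_⟩
  · rw [← pow_add]; exact e24
  · rw [← pow_add]; exact e40
  · rw [mul_zero, pow_zero, mul_one, e20, h16]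
    linear_combination (-1 : ℂ) * p1 + (-1 : ℂ) * p2 - h8 - h16
  · rw [← pow_add, show 20 + 4 * 2 = 28 by norm_num, e28, h16]
    linear_combination (-1 : ℂ) * p2 + (-1 : ℂ) * p3 - h16 - e24
  · rw [← pow_add, show 20 + 4 * 4 = 36 by norm_num, e36]
    linear_combination p1 + p2 + h8 + h16
  · rw [← pow_add, show 20 + 4 * 6 = 44 by norm_num, e44]
    linear_combination p2 + p3 + h16 + e24

/-- ★★ **ROW-COHERENT COST-`5` WEIGHTS LIE IN THE HALF-PLANE `Re(ζ²⁰·) ≥ 0`, THE SLANTED ONES STRICTLY** (`ζ²⁰ = ζ^{−12}`): for a walk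
from a vertical root to the slot `s`, of cost `5` and row-coherent, `Re(ζ²⁰ · limitWeight) = 4·slotDeg s` (`4` if `s ∈ {N, S}`,
`0` if `s ∈ {E, W}`). [cite: GlazmanManolescu2019, §1, Fig. 1 and eq. (1); Lemma 2.1, eq. (CR)] -/
theorem re_zeta20_mul_limitWeight_of_rowCoherent (γ : YBWalk D a z) (ha : vertB a = true) (s : Fin 4)
    (hz : vertB z = (slotDeg s == 0)) (hc : cost s γ.mids = 5) (hcoh : RowCoherent s γ.mids) :
    (zeta32 ^ 20 * limitWeight s γ.mids).re = 4 * (slotDeg s : ℝ) := by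
  rw [limitWeight_eq_phaseIndex γ ha s hz, isolated_eq_of_cost_five hc]
  obtain ⟨hN, hS, hEW⟩ := hcoh
  obtain ⟨v1, v5, v0, v2, v4, v6⟩ := zeta32_row_values
  have hsq := zeta32_four_add_twelve_pow_four; have h5 := zeta32_four_add_twelve_pow_five
  set B := zeta32 ^ 4 + zeta32 ^ 12 with hB
  -- normal forms of the product
  have f4 : ∀ (σ : ℂ) (P : ℂ), zeta32 ^ 20 * (σ * B ^ (4 + 0) * P) = 4 * σ * (zeta32 ^ 20 * P) := by
    intro σ P; rw [add_zero, hsq]; ring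
  have f5 : ∀ (σ : ℂ) (P : ℂ), zeta32 ^ 20 * (σ * B ^ (4 + 1) * P) = 4 * σ * (B * (zeta32 ^ 20 * P)) := by
    intro σ P; rw [h5]; ring
  fin_cases s
  · -- slot `E`
    have hd : slotDeg 0 = 0 := rfl
    have hσ : slotSign 0 = 1 := rfl
    simp only [Fin.zero_eta, Fin.isValue]
    simp only [hd, hσ]; rw [f4]
    rcases hEW (Or.inl rfl) with hX | hX <;> rw [hX] <;> [rw [v1]; rw [v5]] <;> simp
  · -- slot `N`
    have hd : slotDeg 1 = 1 := rfl
    have hσ : slotSign 1 = 1 := rfl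
    simp only [Fin.mk_one, Fin.isValue]
    simp only [hd, hσ]; rw [f5]
    rcases hN rfl with hX | hX <;> rw [hX] <;> [rw [v0]; rw [v2]] <;> simp
  · -- slot `W`
    have hd : slotDeg 2 = 0 := rfl
    have hσ : slotSign 2 = -1 := rfl
    simp only [Fin.reduceFinMk, Fin.isValue]
    simp only [hd, hσ]; rw [f4]
    rcases hEW (Or.inr rfl) with hX | hX <;> rw [hX] <;> [rw [v1]; rw [v5]] <;> simp
  · -- slot `S`
    have hd : slotDeg 3 = 1 := rfl
    have hσ : slotSign 3 = -1 := rfl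
    simp only [Fin.reduceFinMk, Fin.isValue]
    simp only [hd, hσ]; rw [f5]
    rcases hS rfl with hX | hX <;> rw [hX] <;> [rw [v4]; rw [v6]] <;> simp

/-- The side `zz` of a rhombus is vertical iff its slot has degree `0`. [cite: GlazmanManolescu2019, Lemma 2.1, eq. (CR) (lane plumbing)] -/
theorem vertB_side_eq_slotDeg (f₀ : Face) (zz : Side) : vertB (f₀.side zz) = (slotDeg (slotOfSide zz) == 0) := by
  cases zz <;> rfl

end RowCoherent

/-! ## The row-coherence criterion at a hole root -/

section Criterion

variable (Dl : List Face)

open Classical in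
/-- ★★★ **THE ROW-COHERENCE CRITERION.** Let `a = w.side W` be a `W`-normalised hole root of the finite domain `dom Dl` (hole
`(w.1 − 1, w.2)` absent) and `f₀` a rooted rhombus. If every wound group member of limit cost `5` at `f₀` — every wound class-`B2a` walk
of cost `5`, and the cost-`5` class-`B2b` extension of every wound `NS` group — is ROW-COHERENT (slot `N` with phase index `0`/`2`,
`S` with `4`/`6`, `E`/`W` with `1`/`5`), and at least one of them ends on a slanted side (`N` or `S`), then the printed Yang–Baxter
vertex functional `VF_D(a, f₀; ·)` is NOT identically zero in the angle: finitely many zeros in `(0, π)`, at most `4·maxExp − 4`.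
(By the phase law the level-`5` wound limit sum then has `Re(ζ²⁰·Λ₅/lead^K) = 4·#{slanted cost-5 members} > 0`.) This is the form
in which the lane's census law «Λ₅ ≠ 0 on the root row» (kit j271945: all c_w = 5 cells) is to be proved: the classification must
show row-coherence of the cost-`5` members at the cells `(w.1 + k, w.2)`. [cite: GlazmanManolescu2019, Lemma 2.1 and eq. (1)]
[cite: Glazman2015WeightedSAW, Lemma 3.1 (proof)] -/
theorem vertexFunctional_printed_zero_set_finite_of_rowCoherent {w f₀ : Face} (hh : holeFaceW w ∉ dom Dl)
    (hr : RootedFace (dom Dl) (w.side .W) f₀)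
    (hcoh : ∀ ω ∈ (ΩG.setB2a (dom Dl) (w.side .W) f₀).filter (fun ω => ¬ω.Unwound hr),
      (cost (slotOfSide ω.1) ω.2.mids = 5 → RowCoherent (slotOfSide ω.1) ω.2.mids) ∧
        (IsNS ω hr → cost (slotOfSide (ω.ext₃ hr).1) (ω.ext₃ hr).2.mids = 5 →
          RowCoherent (slotOfSide (ω.ext₃ hr).1) (ω.ext₃ hr).2.mids))
    (hex : ∃ ω ∈ (ΩG.setB2a (dom Dl) (w.side .W) f₀).filter (fun ω => ¬ω.Unwound hr),
      (cost (slotOfSide ω.1) ω.2.mids = 5 ∧ slotDeg (slotOfSide ω.1) = 1) ∨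
        (IsNS ω hr ∧ cost (slotOfSide (ω.ext₃ hr).1) (ω.ext₃ hr).2.mids = 5 ∧ slotDeg (slotOfSide (ω.ext₃ hr).1) = 1)) :
    {θ ∈ Set.Ioo 0 π | vertexFunctional (printedWeights θ) tFiveEighths (ybCoeff θ) Dl (w.side .W) f₀ = 0}.Finite ∧
      {θ ∈ Set.Ioo 0 π | vertexFunctional (printedWeights θ) tFiveEighths (ybCoeff θ) Dl (w.side .W) f₀ = 0}.ncard ≤
        4 * maxExp Dl (w.side .W) f₀ + 1 - 5 := by
  have ha : vertB (w.side .W) = true := (vertB_side w).1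
  have hre : ∀ (zz : Side) (γ : YBWalk (dom Dl) (w.side .W) (f₀.side zz)), cost (slotOfSide zz) γ.mids = 5 →
      RowCoherent (slotOfSide zz) γ.mids → (zeta32 ^ 20 * limitWeight (slotOfSide zz) γ.mids).re = 4 * (slotDeg (slotOfSide zz) : ℝ) :=
    fun zz γ hc hco => re_zeta20_mul_limitWeight_of_rowCoherent γ ha (slotOfSide zz) (vertB_side_eq_slotDeg f₀ zz) hc hco
  refine vertexFunctional_printed_zero_set_finite_of_halfPlane_five Dl hh hr (zeta32 ^ 20) (fun ω hω => ?_) ?_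
  · obtain ⟨h1, h2⟩ := hcoh ω hω
    refine ⟨fun hc => ?_, fun hN hc => ?_⟩
    · rw [hre ω.1 ω.2 hc (h1 hc)]; positivity
    · rw [hre (ω.ext₃ hr).1 (ω.ext₃ hr).2 hc (h2 hN hc)]; positivity
  · obtain ⟨ω, hω, hcase⟩ := hex
    obtain ⟨h1, h2⟩ := hcoh ω hω
    refine ⟨ω, hω, ?_⟩
    rcases hcase with ⟨hc, hd⟩ | ⟨hN, hc, hd⟩
    · left; refine ⟨hc, ?_⟩
      rw [hre ω.1 ω.2 hc (h1 hc), hd]; norm_num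
    · right; refine ⟨hN, hc, ?_⟩
      rw [hre (ω.ext₃ hr).1 (ω.ext₃ hr).2 hc (h2 hN hc), hd]; norm_num

end Criterion

end Literature.Barriers.CriticalPhenomena.PlaquetteWalk
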